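/-
Copyright: cell pub-balaban-gaps (YM BLITZ Y1, track G1), seat g1-p2 GEN 11 (unit `pub-balaban-gaps-g1-p2`).  Row (D4) NODE O, MODEL level:
the WEIGHT of the FORM-currency chain (111 ∕ 112 ∕ 113 ∕ 114 ∕ 115) INHABITED on the fine torus: the Combes–Thomas weight centred at a fine
site `j`, `ρ_j(x, a) = η·d₁(x, j)` (`d₁ = T1 P 0`, the periodic ℓ¹ graph distance in fine lattice units; fibre-constant), moves by at most
`ℓ = η` across a fine bond and by at most `ℓ_B = 2d` between two fine sites of one K-block (`ηL^K = 1`) — the hypotheses `hρ`, `hρB`, `hρF` of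
`D4WalkBlockFormBaseTorus` ∕ `…GradientTorus` ∕ `…ShiftTorus` ∕ `…CovOpTorus` ∕ `…AveragingTorus` with the k-FREE values of `ℓ, ℓ_B`.
HONEST FRAMING: torus bookkeeping ([folklore]) on the tree's `T1`, `T`, `blk`, `fine` BY NAME; Bałaban's `Δ^{(k)}(𝐔)` NOT constructed; (D4)
instance 0∕1; NOT BetaPertH, NOT continuum, NOT Clay.
-/
import Summits.QuantumFields.BalabanUV.Gaps.D4WalkBlockCovariantBlockAveraging
import Literature.MathematicalPhysics.QuantumFieldTheory.Balaban1983to89.B6TorusWindowChart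

/-!
# `Gaps.D4WalkBlockFormWeightTorus` — the fine ℓ¹ Combes–Thomas weight `η·d₁(·, j)`: per-bond move `≤ η`, K-block oscillation `≤ 2d`, fibre-constant
# (cell pub-balaban-gaps, seat g1-p2 gen 11)

HONEST DEPENDENCY (cell pub-balaban, verbatim): continuum YM on T⁴ ⇐ BetaPertH ∧ nine spine estimates (0/9 proved); BetaPertH ⇐ (D1) ∧ (D4) ∧ CAP+tail.

[B9] (3.42) p. 399 ∕ Cor. 3.6 p. 408: the local inverses decay at an O(1) rate in UNIT-lattice distance; a weight that realises this rate while
moving by O(η) per fine bond is the fine graph distance scaled by `η` (g1-plan-1 GEN 38 [G1-PLAN1-G38-PRECISION-136] (τ): «k-uniform for a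
FINE-Lipschitz site weight, NOT for a cube-constant one»).  ON THE TREE'S TORUS OBJECTS ([folklore] throughout):
* `T1_shift_le_one` (`d₁(x, x + e_μ) ≤ 1` on the fine torus), `abs_T1_sub_T1_le` (`|d₁(x, j) − d₁(x′, j)| ≤ d₁(x, x′)`),
  `T1_le_of_blk_eq` (`blk x = blk x′ ⟹ d₁(x, x′) ≤ 2d(L^K − 1)`);
* **`fineWeight_shift`** (`|ρ_j(p) − ρ_j(p + e_μ)| ≤ η`), **`fineWeight_block`** ∕ **`fineWeight_block'`** (`|ρ_j(x,b) − ρ_j(x′,b′)| ≤ 2d` on a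
  K-block, in the `Site.proj` and in the `blk` spelling), `fineWeight_fibre` (fibre-constant) — for `ρ_j(x, a) = η·T1 P 0 x j`.
WHAT IT IS NOT.  The assembly with 114 ∕ 115 (olean-gated); (D4) instance 0∕1; words of row (D4) UNCHANGED (`ExistsUniformAcrossSmall 𝓣_Bałaban α Rσ₀ θ₀`
+ `TermDomination`, OBJECT level).

References (method only): T. Bałaban, Comm. Math. Phys. **99** (1985) 389–434 [B9], (3.42) p. 399, Cor. 3.6 p. 408; Comm. Math. Phys. **96** (1984)
223–250 [B6], (2.46) p. 231.
-/

noncomputable section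

namespace Summit.QuantumFields.BalabanUV.Gaps.D4WalkBlockFormWeightTorus

open Finset
open scoped BigOperators
open Literature.MathematicalPhysics.QuantumFieldTheory.Balaban1983to89
open Literature.MathematicalPhysics.QuantumFieldTheory.Balaban1983to89.B5Ineq137Torus (Nv toT blk fine T T_symm T_triangle T_blk_le)
open Literature.MathematicalPhysics.QuantumFieldTheory.Balaban1983to89.B6Prop22OneScaleTorus (T1 T1_le_mul_T)
open Literature.MathematicalPhysics.QuantumFieldTheory.Balaban1983to89.B6Lemma21TowerTorus (T1_triangle T1_symm T1_nonneg)
open Literature.MathematicalPhysics.QuantumFieldTheory.Balaban1983to89.B6TorusWindowChart (T1_le_one_of)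
open Literature.MathematicalPhysics.QuantumFieldTheory.Balaban1983to89.B4TorusKernel.MultiPeriod (circAbs)
open Summit.QuantumFields.BalabanUV.Gaps.D4WalkBlockCovariantGeometry (circAbs_le_one_of)
open Summit.QuantumFields.BalabanUV.Gaps.D4WalkBlockCovariantBlockAveraging (proj_lvl_eq_blk)

variable {P : Params} {F : Type}

/-! ## §1. The fine ℓ¹ distance: one step, Lipschitz, block diameter -/

/-- **one fine step has ℓ¹ length at most one**: `d₁(x, x + e_μ) ≤ 1` on the fine torus. -/
theorem T1_shift_le_one (x : Site P 0) (μ : Fin P.d) : T1 P 0 x (Site.shift x μ) ≤ 1 := by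
  have hn : 1 ≤ P.sitesPerDir 0 := (P.one_lt_sitesPerDir 0).le
  refine T1_le_one_of (μ := μ) (fun ν hν => ?_) ?_
  · unfold Site.shift; rw [Function.update_of_ne hν]
  · unfold B4Sect5Torus.ccoord
    have hsh : Site.shift x μ μ = x μ + 1 := by unfold Site.shift; rw [Function.update_self]
    show (circAbs (P.sitesPerDir 0) (((x μ).val : ℤ) - ((Site.shift x μ μ).val : ℤ))).toNat ≤ 1
    rw [hsh]
    have hv : (x μ).val < P.sitesPerDir 0 := ZMod.val_lt _
    have hc : circAbs (P.sitesPerDir 0) (((x μ).val : ℤ) - ((x μ + 1).val : ℤ)) ≤ 1 := by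
      refine circAbs_le_one_of hn ?_
      rcases Nat.lt_or_ge ((x μ).val + 1) (P.sitesPerDir 0) with hlt | hge
      · have hval : (x μ + 1).val = (x μ).val + 1 := by
          rw [ZMod.val_add, ZMod.val_one_eq_one_mod, Nat.add_mod_mod, Nat.mod_eq_of_lt hlt]
        right; right; left; rw [hval]; push_cast; ring
      · have hval0 : (x μ).val = P.sitesPerDir 0 - 1 := by omega
        have hval : (x μ + 1).val = 0 := by
          rw [ZMod.val_add, ZMod.val_one_eq_one_mod, Nat.add_mod_mod, hval0, Nat.sub_add_cancel hn, Nat.mod_self]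
        right; right; right; right; rw [hval, hval0]; push_cast [hn]; ring
    omega

/-- **`d₁(·, j)` is 1-Lipschitz for `d₁`**: `|d₁(x, j) − d₁(x′, j)| ≤ d₁(x, x′)`. -/
theorem abs_T1_sub_T1_le (x x' j : Site P 0) : |T1 P 0 x j - T1 P 0 x' j| ≤ T1 P 0 x x' := by
  rw [abs_le]
  constructor
  · have h := T1_triangle P 0 x' x j
    rw [T1_symm P 0 x' x] at h
    linarith
  · have h := T1_triangle P 0 x x' j
    linarith

/-- **two fine sites of one K-block are within ℓ¹ distance `2d(L^K − 1)`** (both within sup-distance `L^K − 1` of the block's corner). -/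
theorem T1_le_of_blk_eq {x x' : Site P 0} (h : blk P P.K x = blk P P.K x') : T1 P 0 x x' ≤ 2 * P.d * ((P.L : ℝ) ^ P.K - 1) := by
  have hK : P.K ≤ P.m + P.K := Nat.le_add_left _ _
  have h1 := T_blk_le P hK x
  have h2 := T_blk_le P hK x'
  rw [← h] at h2
  rw [T_symm] at h2
  have ht := T_triangle P 0 x (fine P P.K (blk P P.K x)) x'
  have hd : (0 : ℝ) ≤ P.d := Nat.cast_nonneg _
  calc T1 P 0 x x' ≤ (P.d : ℝ) * T P 0 x x' := T1_le_mul_T P 0 x x'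
    _ ≤ (P.d : ℝ) * (((P.L : ℝ) ^ P.K - 1) + ((P.L : ℝ) ^ P.K - 1)) := mul_le_mul_of_nonneg_left (ht.trans (add_le_add h1 h2)) hd
    _ = 2 * P.d * ((P.L : ℝ) ^ P.K - 1) := by ring

/-! ## §2. The fine Combes–Thomas weight `ρ_j(x, a) = η·d₁(x, j)` -/

/-- **per-bond move `≤ η`** — the `hρ` of the chain with `ℓ = η`. -/
theorem fineWeight_shift (j : Site P 0) (p : Site P 0 × F) (μ : Fin P.d) :
    |P.eps * T1 P 0 p.1 j - P.eps * T1 P 0 (Site.shift p.1 μ, p.2).1 j| ≤ P.eps := by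
  rw [← mul_sub, abs_mul, abs_of_pos P.eps_pos]
  calc P.eps * |T1 P 0 p.1 j - T1 P 0 (Site.shift p.1 μ) j| ≤ P.eps * T1 P 0 p.1 (Site.shift p.1 μ) :=
        mul_le_mul_of_nonneg_left (abs_T1_sub_T1_le _ _ _) P.eps_pos.le
    _ ≤ P.eps * 1 := mul_le_mul_of_nonneg_left (T1_shift_le_one _ _) P.eps_pos.le
    _ = P.eps := mul_one _

/-- **K-block oscillation `≤ 2d`** (`blk` spelling) — the `hρB` of 115 with `ℓ_B = 2d`: `η·2d(L^K − 1) ≤ 2d·(ηL^K) = 2d`. -/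
theorem fineWeight_block' (j : Site P 0) (p q : Site P 0 × F) (h : blk P P.K p.1 = blk P P.K q.1) :
    |P.eps * T1 P 0 p.1 j - P.eps * T1 P 0 q.1 j| ≤ 2 * P.d := by
  rw [← mul_sub, abs_mul, abs_of_pos P.eps_pos]
  have hsp : P.eps * (P.L : ℝ) ^ P.K = 1 := by rw [mul_comm]; exact P.spacing_K
  have hd : (0 : ℝ) ≤ P.d := Nat.cast_nonneg _
  calc P.eps * |T1 P 0 p.1 j - T1 P 0 q.1 j| ≤ P.eps * T1 P 0 p.1 q.1 := mul_le_mul_of_nonneg_left (abs_T1_sub_T1_le _ _ _) P.eps_pos.le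
    _ ≤ P.eps * (2 * P.d * ((P.L : ℝ) ^ P.K - 1)) := mul_le_mul_of_nonneg_left (T1_le_of_blk_eq h) P.eps_pos.le
    _ = 2 * P.d * (P.eps * (P.L : ℝ) ^ P.K) - 2 * P.d * P.eps := by ring
    _ ≤ 2 * P.d := by rw [hsp]; nlinarith [P.eps_pos]

/-- **K-block oscillation `≤ 2d`** (`Site.proj` spelling) — the `hρB` of 112 ∕ 114 with `ℓ_B = 2d`. -/
theorem fineWeight_block (j : Site P 0) (x x' : Site P 0) (b : F)
    (h : Site.proj P.K (B1RG242Torus.lvl P P.K) x' = Site.proj P.K (B1RG242Torus.lvl P P.K) x) :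
    |P.eps * T1 P 0 (x, b).1 j - P.eps * T1 P 0 (x', b).1 j| ≤ 2 * P.d := by
  rw [proj_lvl_eq_blk, proj_lvl_eq_blk] at h
  exact fineWeight_block' j (x, b) (x', b) h.symm

/-- **fibre-constant** — the `hρF` of 113 ∕ 114. -/
theorem fineWeight_fibre (j : Site P 0) (x : Site P 0) (b b' : F) :
    P.eps * T1 P 0 ((x, b) : Site P 0 × F).1 j = P.eps * T1 P 0 ((x, b') : Site P 0 × F).1 j := rfl

end Summit.QuantumFields.BalabanUV.Gaps.D4WalkBlockFormWeightTorus

end
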